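import Mathlib
import HarnessLib
import Summits.AtomisticToContinuum.HydrodynamicLimit.Theses.RelayRaceLocality
import Literature.MathematicalPhysics.KineticTheory.MicroscaleWindowFunctionals

/-!
# RelayRaceLocality · ConeLocalisation — typed statements of the LOCAL STEP of line `Sketch` (zoomed-bubble-transplant)

Second definitions file of the crux item `stmt-AtomisticToContinuum-12504` (line lead
prover-line-stmt-AtomisticToContinuum-12504-0, 2026-08-17), after `…ConeLocalisationDefs.lean` (p132932: `S♭`,
`ConeLocalisationFloored`, `LocalFlooredLLN`). It types, as precise `Prop`s, the stubs into which the line's local step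
`LightConeInLaw → NearConstantShortTimeHL → LocalFlooredLLN` is cut (skeleton `Cruxes/ConeLocalisation/Lines/Sketch.lean`,
v2), so that each lands as its own `--supports` file:

* the universal reduced activity map `Ψ = hsActivity` (`Literature/…/MicroscaleWindowFunctionals.lean`:
  `Ψ(η) = η·exp(f_ex(η) + η f_ex′(η))`; `a₀σ³ = e^{c}Ψ(ρσ³)` is the inversion clause of
  `NearConstantShortTimeHL.staticLLN_explicit`) is REUSED, not redefined; `ScaleDeviation`,
  `ScaleDeviationV` — pointwise `C⁰…C³` deviation bounds from a constant at flattening scale `r` with slope `κ`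
  (`≤ κr, κ, κ/r, κ/r²`).
* `PerCentreComparison` — THE INTERFACE between analysis and probability: for every guard level `M` there are a
  comparison guard level `M′ ≥ M` and a diameter-ratio bound `Λ`, and for every near-constancy target `δ₀ > 0` an
  agreement radius `r` and a comparison life span `Tc`, such that for every profile `(a₀, θ₀, u₀)` and centre `c` there
  is a σ-FREE continuous positive comparison profile `(a₂, θ₂, u₂)` and a threshold `σP` with: whenever `σ < σP` and
  smooth floored-guarded data `(ρ₁, θ₁, u₁)` are the time-`0` LLN limits of the conjunct's local Gibbs laws of
  `(a₀, u₀, θ₀)` (the tie), there are `σ₂ ≤ Λσ` and a classical hs-Euler solution `(R₂, U₂, Θ₂)` on `[0, Tc)` at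
  reduced diameter `σ₂` which AGREES with the data in reduced units on `B(c, r)`, is `δ₀`-near-constant at time `0`,
  obeys the `C¹` guards `M′` on `[0, Tc)`, and whose canonical local Gibbs laws along the COMMENSURATE family
  `(hsDiameter σ N, ⌈(σ₂/σ)³(N+1)⌉₊)` are probability measures satisfying the time-`0` law of large numbers towards
  `(R₂, U₂, Θ₂)(0)` — exactly the hypotheses `LightConeInLaw` and `NearConstantShortTimeHL` ask of "gas 2".
* `FugacityStatics` — the statics feeding it: (1) identification of the tied data (`u₁ = u₀`, `θ₁ = θ₀`, band, unit
  mass, `a₀σ³ = e^{c₁}Ψ(ρ₁σ³)`); (2) matched activity `bσ₂³ = e^{c₂}Ψ(ρ₂σ₂³)` with `ρ₂ ∈ [½, 2]` of unit mass ⇒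
  probability and time-`0` LLN of the canonical laws of `(b, u₂, θ₂)` along the commensurate family, `σ₂³ ≤ Kσ³`.
* `FlatteningLinear` — smooth cutoffs `ψ` (`= 1` on `B(c, r)`, `= 0` off `B(c, 2r)`, `|∂ᵏψ| ≤ Cψ/rᵏ`) and the
  scale-`r` bounds of the linear flattenings `ψ f + (1-ψ) f(c)`, `ψ w + (1-ψ) w(c)`.
* `FlatteningDensity` — the nonlinear flattening of the reduced density through `Ψ`:
  `Ψ(η₂) = ψΨ(ρ₁σ³) + (1-ψ)Ψ(ρ₁(c)σ³)` has a smooth positive solution `η₂` with total mass in `[σ³/(2M), 2Mσ³]`,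
  relative oscillation `≤ CF·r` (HERE the density floor `M⁻¹ ≤ ρ₁` enters) and scale-`r` bounds.
* `BubbleAtScale` — the PDE stub: small bubbles at scale `r ≤ 1/16` around a guarded constant state have classical
  hs-Euler solutions on `[0, r s₀)` with `C⁰` deviation `≤ Cκr` and `C¹` deviation `≤ Cκ`, `C, s₀, ε₀` INDEPENDENT of
  `r` and `σ` (hyperbolic zoom + small-data stability at unit scale + domain of dependence).

Composition in the skeleton: `BubbleAtScale → FugacityStatics → FlatteningLinear → FlatteningDensity →
PerCentreComparison` (`stub_comparison`) and `PerCentreComparison → LightConeInLaw → NearConstantShortTimeHL →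
LocalFlooredLLN` (`stub_coneStep`). `Prop`s and the two `ScaleDeviation` predicates only; nothing is asserted.
-/

noncomputable section

namespace Summit.AtomisticToContinuum.HydrodynamicLimit.Theorems.ConeLocalisation

open scoped Topology
open Filter Set MeasureTheory
open Literature.MathematicalPhysics.KineticTheory Literature.Analysis.FluidPDE
  Literature.Analysis.FunctionSpaces
open Summit.AtomisticToContinuum.HydrodynamicLimit.Theses.RelayRaceLocality

/-- Pointwise `C⁰…C³` **deviation bounds at flattening scale `r` with slope `κ`** of a scalar field from the constant
`b`: `|f - b| ≤ κ r`, `|∂f| ≤ κ`, `|∂²f| ≤ κ/r`, `|∂³f| ≤ κ/r²` (`Torus.partialDeriv` words). [folklore] -/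
@[folklore] def ScaleDeviation (f : T3 → ℝ) (b r κ : ℝ) : Prop :=
  ∀ x, |f x - b| ≤ κ * r ∧ ∀ i j k : Fin 3, |Torus.partialDeriv i f x| ≤ κ ∧
    |Torus.partialDeriv i (Torus.partialDeriv j f) x| ≤ κ / r ∧
    |Torus.partialDeriv i (Torus.partialDeriv j (Torus.partialDeriv k f)) x| ≤ κ / r ^ 2

/-- The same for a vector field (norms). [folklore] -/
@[folklore] def ScaleDeviationV (w : T3 → V3) (b : V3) (r κ : ℝ) : Prop :=
  ∀ x, ‖w x - b‖ ≤ κ * r ∧ ∀ i j k : Fin 3, ‖Torus.partialDeriv i w x‖ ≤ κ ∧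
    ‖Torus.partialDeriv i (Torus.partialDeriv j w) x‖ ≤ κ / r ∧
    ‖Torus.partialDeriv i (Torus.partialDeriv j (Torus.partialDeriv k w)) x‖ ≤ κ / r ^ 2

/-- **`PerCentreComparison` — the comparison gases of the glue exist** (interface between the analysis stubs and the
cone step; see the module docstring for the reading). [folklore] -/
@[conjecture] def PerCentreComparison : Prop :=
    ∃ ηP : ℝ, 0 < ηP ∧ ∀ M : ℝ, 0 < M → ∃ M' : ℝ, M ≤ M' ∧ ∃ Λ : ℝ, 1 ≤ Λ ∧ ∀ δ₀ : ℝ, 0 < δ₀ → ∃ r : ℝ, 0 < r ∧ ∃ Tc : ℝ, 0 < Tc ∧ ∀ (a₀ θ₀ : T3 → ℝ) (u₀ : T3 → V3), Continuous a₀ → Continuous θ₀ → Continuous u₀ → (∀ x, 0 < a₀ x) → (∀ x, 0 < θ₀ x) → ∀ c : T3, ∃ (a₂ θ₂ : T3 → ℝ) (u₂ : T3 → V3), Continuous a₂ ∧ Continuous θ₂ ∧ Continuous u₂ ∧ (∀ x, 0 < a₂ x) ∧ (∀ x, 0 < θ₂ x) ∧ ∃ σP : ℝ, 0 < σP ∧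 ∀ σ : ℝ, 0 < σ → σ < σP → ∀ (ρ₁ θ₁ : T3 → ℝ) (u₁ : T3 → V3), Torus.IsSmooth ρ₁ → Torus.IsSmooth θ₁ → Torus.IsSmooth u₁ → (∀ x, ρ₁ x * σ ^ 3 ≤ ηP ∧ M⁻¹ ≤ ρ₁ x ∧ ρ₁ x ≤ M ∧ M⁻¹ ≤ θ₁ x ∧ θ₁ x ≤ M ∧ ‖u₁ x‖ ≤ M ∧ ∀ i j k : Fin 3, |Torus.partialDeriv i ρ₁ x| ≤ M ∧ ‖Torus.partialDeriv i u₁ x‖ ≤ M ∧ |Torus.partialDeriv i θ₁ x| ≤ M ∧ |Torus.partialDeriv i (Torus.partialDeriv j ρ₁) x| ≤ M ∧ ‖Torus.partialDeriv i (Torus.partialDeriv j u₁) x‖ ≤ M ∧ |Torus.partialDeriv i (Torus.partialDeriv j θ₁) x| ≤ M ∧ |Torus.partialDeriv i (Torus.partialDeriv j (Torus.partialDeriv k ρ₁)) x| ≤ M ∧ ‖Torus.partialDeriv i (Torus.partialDeriv j (Torus.partialDeriv k u₁)) x‖ ≤ M ∧ |Torus.partialDeriv i (Torus.partialDeriv j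 (Torus.partialDeriv k θ₁)) x| ≤ M) → ∀ Φ₁ : (N : ℕ) → HardSphereFlow (Torus.geometry (Fin 3)) (hsDiameter σ N) (N + 1), TendstoHydroFieldsAt (fun N => localGibbsLaw σ a₀ u₀ θ₀ N (Φ₁ N)) Φ₁ (fun _ => ρ₁) (fun _ => u₁) (fun _ => θ₁) 0 → ∃ σ₂ : ℝ, 0 < σ₂ ∧ σ₂ ≤ Λ * σ ∧ ∃ (R₂ Θ₂ : ℝ → T3 → ℝ) (U₂ : ℝ → T3 → V3), IsHardSphereEulerSolution σ₂ Tc R₂ U₂ Θ₂ ∧ (∀ x, Torus.euclidDist x c < r → ρ₁ x * σ ^ 3 = R₂ 0 x * σ₂ ^ 3 ∧ u₁ x = U₂ 0 x ∧ θ₁ x = Θ₂ 0 x) ∧ (∃ (ubar : V3) (θbar : ℝ), ∀ x, |R₂ 0 x - 1| ≤ δ₀ ∧ ‖U₂ 0 x - ubar‖ ≤ δ₀ ∧ |Θ₂ 0 x - θbar| ≤ δ₀) ∧ (∀ s ∈ Set.Ico 0 Tc, ∀ x, R₂ s x ≤ M' ∧ Θ₂ s x ≤ M' ∧ M'⁻¹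 ≤ Θ₂ s x ∧ ‖U₂ s x‖ ≤ M' ∧ ∀ i : Fin 3, |Torus.partialDeriv i (R₂ s) x| ≤ M' ∧ ‖Torus.partialDeriv i (U₂ s) x‖ ≤ M' ∧ |Torus.partialDeriv i (Θ₂ s) x| ≤ M') ∧ (let n₂ : ℕ → ℕ := fun N => ⌈(σ₂ / σ) ^ 3 * ((N + 1 : ℕ) : ℝ)⌉₊; ∀ Φ₂ : (N : ℕ) → HardSphereFlow (Torus.geometry (Fin 3)) (hsDiameter σ N) (n₂ N), let P₂ : (N : ℕ) → Measure (Config (n₂ N) (Fin 3) T3) := fun N => particleLaw (Φ₂ N) (canonicalDensity (Torus.geometry (Fin 3)) (hsDiameter σ N) (n₂ N) (localGibbsProfile a₂ u₂ θ₂)); (∀ N, IsProbabilityMeasure (P₂ N)) ∧ ∀ χ : T3 → ℝ, Continuous χ → ∀ δ : ℝ, 0 < δ → Tendsto (fun N => P₂ N {z | δ < |empiricalDensityField ((Φ₂ N).flow 0 z) χ - ∫ x, χ x * R₂ 0 x|}) atTop (nhds 0) ∧ Tendsto (fun N => P₂ N {z | δ < ‖empiricalMomentumField ((Φ₂ N).flow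 0 z) χ - ∫ x, (χ x * R₂ 0 x) • U₂ 0 x‖}) atTop (nhds 0) ∧ Tendsto (fun N => P₂ N {z | δ < |empiricalEnergyField ((Φ₂ N).flow 0 z) χ - ∫ x, χ x * totalEnergyDensity (R₂ 0 x) (U₂ 0 x) (Θ₂ 0 x)|}) atTop (nhds 0))

/-- **`FugacityStatics` — low-density canonical statics behind the comparison gas.** For continuous positive
profiles: a bound `Λ⁻¹ ≤ a₀ ≤ Λ`, and for every diameter-ratio bound `K ≥ 1` a threshold `σS` such that (1) tied
time-`0` LLN limits `(ρ₁, u₁, θ₁)` of the conjunct's local Gibbs laws of `(a₀, u₀, θ₀)` at `σ < σS` are identified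
(`u₁ = u₀`, `θ₁ = θ₀`, `ρ₁` in the band `[(2Λ²)⁻¹, 2Λ²]`, unit mass, `a₀σ³ = e^{c₁}Ψ(ρ₁σ³)`), and (2) every activity
`b` of MATCHED form `bσ₂³ = e^{c₂}Ψ(ρ₂σ₂³)` with `ρ₂ ∈ [½, 2]` continuous of unit mass, `σ₂³ ≤ Kσ³`, has canonical
local Gibbs laws along the commensurate family `(hsDiameter σ N, ⌈(σ₂/σ)³(N+1)⌉₊)` that are probability measures and
satisfy the time-`0` law of large numbers towards `(ρ₂, u₂, θ₂)` (`staticLLN_explicit`, `profiles_eq_of_tendsto`,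
`stub_concentrationGeneralFamilies`, `canonicalDensity_const_mul`, lattice packing). [folklore] -/
@[conjecture] def FugacityStatics : Prop :=
    ∀ (a₀ θ₀ : T3 → ℝ) (u₀ : T3 → V3), Continuous a₀ → Continuous θ₀ → Continuous u₀ → (∀ x, 0 < a₀ x) → (∀ x, 0 < θ₀ x) → ∃ Λ : ℝ, 1 ≤ Λ ∧ (∀ x, Λ⁻¹ ≤ a₀ x ∧ a₀ x ≤ Λ) ∧ ∀ K : ℝ, 1 ≤ K → ∃ σS : ℝ, 0 < σS ∧ (∀ σ : ℝ, 0 < σ → σ < σS → ∀ (ρ₁ θ₁ : T3 → ℝ) (u₁ : T3 → V3), Continuous ρ₁ → Continuous θ₁ → Continuous u₁ → ∀ Φ₁ : (N : ℕ) → HardSphereFlow (Torus.geometry (Fin 3)) (hsDiameter σ N) (N + 1), TendstoHydroFieldsAt (fun N => localGibbsLaw σ a₀ u₀ θ₀ N (Φ₁ N)) Φ₁ (fun _ => ρ₁) (fun _ => u₁) (fun _ => θ₁) 0 → u₁ = u₀ ∧ θ₁ = θ₀ ∧ (∀ x, (2 * Λ ^ 2)⁻¹ ≤ ρ₁ x ∧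 ρ₁ x ≤ 2 * Λ ^ 2) ∧ (∫ x, ρ₁ x) = 1 ∧ ∃ c₁ : ℝ, ∀ x, a₀ x * σ ^ 3 = Real.exp c₁ * hsActivity (ρ₁ x * σ ^ 3)) ∧ (∀ σ : ℝ, 0 < σ → σ < σS → ∀ σ₂ : ℝ, 0 < σ₂ → σ₂ ^ 3 ≤ K * σ ^ 3 → ∀ (b θ₂ ρ₂ : T3 → ℝ) (u₂ : T3 → V3), Continuous θ₂ → Continuous u₂ → Continuous ρ₂ → (∀ x, 0 < θ₂ x) → (∀ x, 2⁻¹ ≤ ρ₂ x ∧ ρ₂ x ≤ 2) → (∫ x, ρ₂ x) = 1 → ∀ c₂ : ℝ, (∀ x, b x * σ₂ ^ 3 = Real.exp c₂ * hsActivity (ρ₂ x * σ₂ ^ 3)) → let n₂ : ℕ → ℕ := fun N => ⌈(σ₂ / σ) ^ 3 * ((N + 1 : ℕ) : ℝ)⌉₊; ∀ Φ₂ : (N : ℕ) → HardSphereFlow (Torus.geometry (Fin 3)) (hsDiameter σ N) (n₂ N), let P₂ : (N : ℕ) → Measure (Config (n₂ N) (Fin 3) T3) := fun N => particleLaw (Φ₂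 N) (canonicalDensity (Torus.geometry (Fin 3)) (hsDiameter σ N) (n₂ N) (localGibbsProfile b u₂ θ₂)); (∀ N, IsProbabilityMeasure (P₂ N)) ∧ ∀ χ : T3 → ℝ, Continuous χ → ∀ δ : ℝ, 0 < δ → Tendsto (fun N => P₂ N {z | δ < |empiricalDensityField ((Φ₂ N).flow 0 z) χ - ∫ x, χ x * ρ₂ x|}) atTop (nhds 0) ∧ Tendsto (fun N => P₂ N {z | δ < ‖empiricalMomentumField ((Φ₂ N).flow 0 z) χ - ∫ x, (χ x * ρ₂ x) • u₂ x‖}) atTop (nhds 0) ∧ Tendsto (fun N => P₂ N {z | δ < |empiricalEnergyField ((Φ₂ N).flow 0 z) χ - ∫ x, χ x * totalEnergyDensity (ρ₂ x) (u₂ x) (θ₂ x)|}) atTop (nhds 0))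

/-- **`FlatteningLinear` — smooth cutoffs on `𝕋³` and the linear flattening at scale `r`.** An absolute constant
`Cψ` and, for every `0 < r ≤ 1/16` and centre `c`, a smooth cutoff `ψ : 𝕋³ → [0, 1]`, `= 1` on `B(c, r)`, `= 0` off
`B(c, 2r)`, `|∂ᵏψ| ≤ Cψ r^{-k}` (`k ≤ 3`), such that for fields with `C⁰…C³` bounds `M` the flattened fields
`ψ f + (1 - ψ) f(c)` (scalar) and `ψ w + (1 - ψ) w(c)` (vector) are smooth, agree with the field on `B(c, r)`, equal
its value at `c` off `B(c, 2r)`, and deviate from it at scale `r` with slope `Cψ M` (`ScaleDeviation`). [folklore] -/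
@[conjecture] def FlatteningLinear : Prop :=
    ∃ Cψ : ℝ, 0 < Cψ ∧ ∀ r : ℝ, 0 < r → r ≤ 1 / 16 → ∀ c : T3, ∃ ψ : T3 → ℝ, Torus.IsSmooth ψ ∧ (∀ x, 0 ≤ ψ
    x ∧ ψ x ≤ 1) ∧ (∀ x, Torus.euclidDist x c < r → ψ x = 1) ∧ (∀ x, 2 * r ≤ Torus.euclidDist x c → ψ x = 0)
    ∧ (∀ x, ∀ i j k : Fin 3, |Torus.partialDeriv i ψ x| ≤ Cψ / r ∧ |Torus.partialDeriv i (Torus.partialDeriv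
    j ψ) x| ≤ Cψ / r ^ 2 ∧ |Torus.partialDeriv i (Torus.partialDeriv j (Torus.partialDeriv k ψ)) x| ≤ Cψ / r
    ^ 3) ∧ ∀ M : ℝ, 0 < M → (∀ f : T3 → ℝ, Torus.IsSmooth f → (∀ x, |f x| ≤ M ∧ ∀ i j k : Fin 3,
    |Torus.partialDeriv i f x| ≤ M ∧ |Torus.partialDeriv i (Torus.partialDeriv j f) x| ≤ M ∧
    |Torus.partialDeriv i (Torus.partialDeriv j (Torus.partialDeriv k f)) x| ≤ M) → Torus.IsSmooth (fun x =>
    ψ x * f x + (1 - ψ x) * f c) ∧ (∀ x, Torus.euclidDist x c < r → ψ x * f x + (1 - ψ x) * f c = f x) ∧ (∀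
    x, 2 * r ≤ Torus.euclidDist x c → ψ x * f x + (1 - ψ x) * f c = f c) ∧ ScaleDeviation (fun x => ψ x * f
    x + (1 - ψ x) * f c) (f c) r (Cψ * M)) ∧ (∀ w : T3 → V3, Torus.IsSmooth w → (∀ x, ‖w x‖ ≤ M ∧ ∀ i j k :
    Fin 3, ‖Torus.partialDeriv i w x‖ ≤ M ∧ ‖Torus.partialDeriv i (Torus.partialDeriv j w) x‖ ≤ M ∧
    ‖Torus.partialDeriv i (Torus.partialDeriv j (Torus.partialDeriv k w)) x‖ ≤ M) → Torus.IsSmooth (fun x =>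
    ψ x • w x + (1 - ψ x) • w c) ∧ (∀ x, Torus.euclidDist x c < r → ψ x • w x + (1 - ψ x) • w c = w x) ∧ (∀
    x, 2 * r ≤ Torus.euclidDist x c → ψ x • w x + (1 - ψ x) • w c = w c) ∧ ScaleDeviationV (fun x => ψ x • w
    x + (1 - ψ x) • w c) (w c) r (Cψ * M))

/-- **`FlatteningDensity` — the nonlinear flattening of the reduced density through the activity map `Ψ`.**
There is a band `ηF > 0` and, for every guard level `M` and cutoff constant `Cψ`, a constant `CF` such that for
every cutoff `ψ` as in `FlatteningLinear`, every `σ > 0` and every smooth `ρ₁` with `M⁻¹ ≤ ρ₁ ≤ M`, `ρ₁σ³ ≤ ηF` and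
derivatives of order `≤ 3` bounded by `M`, the equation `Ψ(η₂) = ψ Ψ(ρ₁σ³) + (1 - ψ) Ψ(ρ₁(c)σ³)` has a smooth positive
solution `η₂` (inverse function of `Ψ` on the band, where `Ψ′ > 0` by the analytic low-density equation of state),
equal to `ρ₁σ³` on `B(c, r)` and to `ρ₁(c)σ³` off `B(c, 2r)`, with total mass in `[σ³/(2M), 2Mσ³]`, unit-mass
normalisation `η₂/∫η₂` within `CF·r` of `1` (THIS is where the density floor enters) and deviating from the
normalised far value at scale `r` with slope `CF`. [folklore] -/
@[conjecture] def FlatteningDensity : Prop :=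
    ∃ ηF : ℝ, 0 < ηF ∧ ∀ M : ℝ, 0 < M → ∀ Cψ : ℝ, 0 < Cψ → ∃ CF : ℝ, 0 < CF ∧ ∀ r : ℝ, 0 < r → r ≤ 1 / 16 →
    ∀ c : T3, ∀ ψ : T3 → ℝ, Torus.IsSmooth ψ → (∀ x, 0 ≤ ψ x ∧ ψ x ≤ 1) → (∀ x, Torus.euclidDist x c < r → ψ
    x = 1) → (∀ x, 2 * r ≤ Torus.euclidDist x c → ψ x = 0) → (∀ x, ∀ i j k : Fin 3, |Torus.partialDeriv i ψ
    x| ≤ Cψ / r ∧ |Torus.partialDeriv i (Torus.partialDeriv j ψ) x| ≤ Cψ / r ^ 2 ∧ |Torus.partialDeriv i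
    (Torus.partialDeriv j (Torus.partialDeriv k ψ)) x| ≤ Cψ / r ^ 3) → ∀ σ : ℝ, 0 < σ → ∀ ρ₁ : T3 → ℝ,
    Torus.IsSmooth ρ₁ → (∀ x, ρ₁ x * σ ^ 3 ≤ ηF ∧ M⁻¹ ≤ ρ₁ x ∧ ρ₁ x ≤ M ∧ ∀ i j k : Fin 3,
    |Torus.partialDeriv i ρ₁ x| ≤ M ∧ |Torus.partialDeriv i (Torus.partialDeriv j ρ₁) x| ≤ M ∧
    |Torus.partialDeriv i (Torus.partialDeriv j (Torus.partialDeriv k ρ₁)) x| ≤ M) → ∃ η₂ : T3 → ℝ,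
    Torus.IsSmooth η₂ ∧ (∀ x, 0 < η₂ x) ∧ (∀ x, hsActivity (η₂ x) = ψ x * hsActivity (ρ₁ x * σ ^
    3) + (1 - ψ x) * hsActivity (ρ₁ c * σ ^ 3)) ∧ (∀ x, Torus.euclidDist x c < r → η₂ x = ρ₁ x * σ ^ 3)
    ∧ (∀ x, 2 * r ≤ Torus.euclidDist x c → η₂ x = ρ₁ c * σ ^ 3) ∧ (2 * M)⁻¹ * σ ^ 3 ≤ (∫ x, η₂ x) ∧ (∫ x, η₂
    x) ≤ 2 * M * σ ^ 3 ∧ (∀ x, |η₂ x / (∫ y, η₂ y) - 1| ≤ CF * r) ∧ |ρ₁ c * σ ^ 3 / (∫ y, η₂ y) - 1| ≤ CF *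
    r ∧ ScaleDeviation (fun x => η₂ x / ∫ y, η₂ y) (ρ₁ c * σ ^ 3 / ∫ y, η₂ y) r CF

/-- **`BubbleAtScale` — the PDE stub: bubbles at scale `r` with an `r`-FREE `C¹` guard.** A packing threshold `η₁`
and, for every guard level `M`, a zoomed life span `s₀`, a smallness `ε₀` and a constant `C` such that for every
reduced diameter `σ > 0`, every constant state `(ρ̄, θ̄, ū)` in the guarded box with `ρ̄σ³ ≤ η₁`, every
`0 < r ≤ 1/16`, `κ ≥ 0` with `κ r ≤ ε₀`, every centre and all smooth data EQUAL to the constant state outside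
`B(x₀, 2r)` with `ScaleDeviation` bounds (slope `κ`), the hard-sphere Euler system has a classical solution on
`[0, r s₀)` from these data whose deviation stays `≤ Cκr` in `C⁰` and `≤ Cκ` in `C¹` — independently of `r` and `σ` —
and which equals the constant state outside `B(x₀, 4r)` (device: hyperbolic zoom `(t, x) ↦ (t/2r, (x - x₀)/2r)` of
the compactly supported bubble, small-data stability at unit scale, finite domain of dependence against the constant
solution `LightConeInLawSketch.DoD.cone_unique_of_smooth_eos`, un-zoom). [folklore] -/
@[conjecture] def BubbleAtScale : Prop :=
    ∃ η₁ : ℝ, 0 < η₁ ∧ ∀ M : ℝ, 0 < M → ∃ s₀ : ℝ, 0 < s₀ ∧ ∃ ε₀ : ℝ, 0 < ε₀ ∧ ∃ C : ℝ, 0 < C ∧ ∀ σ : ℝ, 0 <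
    σ → ∀ (ρbar θbar : ℝ) (ubar : V3), M⁻¹ ≤ ρbar → ρbar ≤ M → ρbar * σ ^ 3 ≤ η₁ → M⁻¹ ≤ θbar → θbar ≤ M →
    ‖ubar‖ ≤ M → ∀ (r κ : ℝ), 0 < r → r ≤ 1 / 16 → 0 ≤ κ → κ * r ≤ ε₀ → ∀ (x₀ : T3) (ρ₀ θ₀ : T3 → ℝ) (u₀ :
    T3 → V3), Torus.IsSmooth ρ₀ → Torus.IsSmooth θ₀ → Torus.IsSmooth u₀ → (∀ x, 2 * r ≤ Torus.euclidDist x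
    x₀ → ρ₀ x = ρbar ∧ θ₀ x = θbar ∧ u₀ x = ubar) → ScaleDeviation ρ₀ ρbar r κ → ScaleDeviation θ₀ θbar r κ
    → ScaleDeviationV u₀ ubar r κ → ∃ (ρ θ : ℝ → T3 → ℝ) (u : ℝ → T3 → V3), IsHardSphereEulerSolution σ (r *
    s₀) ρ u θ ∧ ρ 0 = ρ₀ ∧ θ 0 = θ₀ ∧ u 0 = u₀ ∧ (∀ s ∈ Set.Ico 0 (r * s₀), ∀ x, |ρ s x - ρbar| ≤ C * κ * r
    ∧ |θ s x - θbar| ≤ C * κ * r ∧ ‖u s x - ubar‖ ≤ C * κ * r ∧ ∀ i : Fin 3, |Torus.partialDeriv i (ρ s) x|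
    ≤ C * κ ∧ ‖Torus.partialDeriv i (u s) x‖ ≤ C * κ ∧ |Torus.partialDeriv i (θ s) x| ≤ C * κ) ∧ (∀ s ∈
    Set.Ico 0 (r * s₀), ∀ x, 4 * r ≤ Torus.euclidDist x x₀ → ρ s x = ρbar ∧ θ s x = θbar ∧ u s x = ubar)

end Summit.AtomisticToContinuum.HydrodynamicLimit.Theorems.ConeLocalisation

end
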